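import Mathlib
import HarnessLib
import Summits.NavierStokesRegularity.NavierStokesRegularity.Theorems.UnthreadedRigidityDoorUnthreadedRigidityVirialHornTwoChannelPlateauSources
import Summits.NavierStokesRegularity.NavierStokesRegularity.Theorems.UnthreadedRigidityDoorUnthreadedRigidityThreadingJetsRungClosures

/-!
# Route `UnthreadedRigidityDoor`, item `UnthreadedRigidity` (W2, stmt-NavierStokesRegularity-27585) — LINE g11-1 «VIRIAL HORN»,
# BRIDGE V BY NAME («PLATEAU PROPAGATION»), file 12: THE TRIANGULAR CASCADE ON A PLATEAU IS KILLED BY AN INTEGER EULER PRODUCT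

Prover file (W2 Lean hand ns-crc-p1 g10, by lineage; `--supports stmt-NavierStokesRegularity-27585 --as helper`; objects BY NAME in
`Theorems/UnthreadedRigidityDoorUnthreadedRigidityVirialHornTwoChannelDefs.lean`, p726708 / p728780 and its second append).

Content: integer-list bookkeeping (`map_cast_append`, `map_cast_sub`), closure of «killed by an integer Euler product on `U`» under sums,
scalars, `r^d`, one more Euler factor (commutation) and agreement on `U`; ★ `eulerOp_eulerOp_comp_sq` (the r-picture of the radial ODE:
`4s g″ + (4L+6) g′ = −src` on `[0,∞)` ⇒ `(rD)(rD + 2L + 1) g(r²) = −r²·src(r²)` on `(0,∞)`), and ★★ `plateau_cascade_killed`: on a plateau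
interval every level `r ↦ g_k(r²)` of the cascade is annihilated by an explicit (existentially packaged) product of Euler factors with integer
constants (induction on the level: the source and the previous level are killed, multiply by `−r²`, compose with `(rD)(rD+2L_k+1)`).
HONEST LABEL: slice-level calculus / real analysis about SPECIAL (separable) data; a piece of the L-part of ONE bridge of a RUNG line on the
wall item; `UnthreadedRigidity` (27585), W2 and NS regularity remain OPEN; nothing here is a statement about Navier–Stokes regularity.  0 kit.
-/

-- the summit and its single sub-problem share the name (CONVENTIONS §1), as in every Theorems file
set_option linter.dupNamespace false

namespace Summit.NavierStokesRegularity.NavierStokesRegularity.Theorems.UnthreadedRigidity.VirialHorn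

open scoped RealInnerProductSpace Topology Laplacian
open Filter Set MvPolynomial
open Literature.Combinatorics.LorentzianPolynomials (pderiv_pderiv_comm)
open Summit.NavierStokesRegularity.NavierStokesRegularity.Theorems.UnthreadedRigidity.ProfileHorn (E3)
open Summit.NavierStokesRegularity.NavierStokesRegularity.Theorems.UnthreadedRigidity.HornPressure (radCoeff)
open Summit.NavierStokesRegularity.NavierStokesRegularity.Theorems.PoloidalLiouville.HorizonTower hiding E3

/-! ## §13 PLATEAU PROPAGATION: the cascade and the premise on a plateau, the gluing, and BRIDGE V BY NAME -/

section Propagation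

open scoped ContDiff
open MeasureTheory Literature.Analysis.FluidPDE
open Summit.NavierStokesRegularity.NavierStokesRegularity.Theorems.UnthreadedRigidity.ThreadingJets
  (fluxJetTwo virialLemmaSlice_holds orderTwoVirialIdentity_of_sliceLaw virialMoment_eq_zero_of_vortAmpL_eq_zero)

variable {l : ℕ} {P : MvPolynomial (Fin 3) ℝ} {H h : ℝ → ℝ} {C : ℝ} {x₀ : E3} {p₀ : E3 → ℝ}

/-- integer lists: concatenation commutes with the cast to `ℝ`. -/
theorem map_cast_append (zs ws : List ℤ) :
    (zs ++ ws).map (Int.cast : ℤ → ℝ) = zs.map (Int.cast : ℤ → ℝ) ++ ws.map (Int.cast : ℤ → ℝ) := List.map_append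

/-- integer lists: shifting commutes with the cast to `ℝ`. -/
theorem map_cast_sub (zs : List ℤ) (d : ℕ) :
    (zs.map (Int.cast : ℤ → ℝ)).map (fun c => c - (d : ℝ)) = (zs.map fun z => z - (d : ℤ)).map (Int.cast : ℤ → ℝ) := by
  rw [List.map_map, List.map_map]; congr 1; funext z; simp

/-- KILLED (by an integer Euler product, on `U`): closure under sums. -/
theorem killed_add {U : Set ℝ} (hU : IsOpen U) (hUI : U ⊆ Ioi 0) {f g : ℝ → ℝ} (hf : ContDiffOn ℝ ∞ f (Ioi 0))
    (hg : ContDiffOn ℝ ∞ g (Ioi 0)) (h₁ : ∃ zs : List ℤ, EqOn (eulerL (zs.map (Int.cast : ℤ → ℝ)) f) 0 U)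
    (h₂ : ∃ zs : List ℤ, EqOn (eulerL (zs.map (Int.cast : ℤ → ℝ)) g) 0 U) :
    ∃ zs : List ℤ, EqOn (eulerL (zs.map (Int.cast : ℤ → ℝ)) (fun x => f x + g x)) 0 U := by
  obtain ⟨zs, hz⟩ := h₁; obtain ⟨ws, hw⟩ := h₂
  exact ⟨zs ++ ws, by rw [map_cast_append]; exact eulerL_add_eqOn_zero hU hUI hf hg hz hw⟩

/-- KILLED: closure under scalar multiples. -/
theorem killed_const_mul {U : Set ℝ} (hUI : U ⊆ Ioi 0) {f : ℝ → ℝ} (hf : ContDiffOn ℝ ∞ f (Ioi 0)) (K : ℝ)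
    (h : ∃ zs : List ℤ, EqOn (eulerL (zs.map (Int.cast : ℤ → ℝ)) f) 0 U) :
    ∃ zs : List ℤ, EqOn (eulerL (zs.map (Int.cast : ℤ → ℝ)) (fun x => K * f x)) 0 U := by
  obtain ⟨zs, hz⟩ := h
  exact ⟨zs, eulerL_const_mul_eqOn_zero hUI hf K hz⟩

/-- KILLED: closure under multiplication by `r^d`. -/
theorem killed_pow_mul {U : Set ℝ} (hUI : U ⊆ Ioi 0) {f : ℝ → ℝ} (hf : ContDiffOn ℝ ∞ f (Ioi 0)) (d : ℕ)
    (h : ∃ zs : List ℤ, EqOn (eulerL (zs.map (Int.cast : ℤ → ℝ)) f) 0 U) :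
    ∃ zs : List ℤ, EqOn (eulerL (zs.map (Int.cast : ℤ → ℝ)) (fun x => x ^ d * f x)) 0 U := by
  obtain ⟨zs, hz⟩ := h
  refine ⟨zs.map fun z => z - (d : ℤ), ?_⟩
  rw [← map_cast_sub]
  exact eulerL_pow_mul_eqOn_zero hUI hf d hz

/-- KILLED: closure under one more Euler factor with integer constant (commutation). -/
theorem killed_eulerOp {U : Set ℝ} (hU : IsOpen U) (hUI : U ⊆ Ioi 0) {f : ℝ → ℝ} (hf : ContDiffOn ℝ ∞ f (Ioi 0)) (c : ℤ)
    (h : ∃ zs : List ℤ, EqOn (eulerL (zs.map (Int.cast : ℤ → ℝ)) f) 0 U) :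
    ∃ zs : List ℤ, EqOn (eulerL (zs.map (Int.cast : ℤ → ℝ)) (eulerOp (c : ℝ) f)) 0 U := by
  obtain ⟨zs, hz⟩ := h
  refine ⟨zs, fun r hr => ?_⟩
  have h1 := (eulerOp_eulerL_comm hf (c : ℝ) (zs.map (Int.cast : ℤ → ℝ))).symm (hUI hr)
  rw [h1, eulerOp_congr_eqOn hU hz (c : ℝ) hr]
  show r * deriv (fun _ : ℝ => (0 : ℝ)) r + (c : ℝ) * 0 = 0
  simp

/-- KILLED: closure under agreement on `U`. -/
theorem killed_congr {U : Set ℝ} (hU : IsOpen U) {f g : ℝ → ℝ} (hfg : EqOn f g U)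
    (h : ∃ zs : List ℤ, EqOn (eulerL (zs.map (Int.cast : ℤ → ℝ)) f) 0 U) :
    ∃ zs : List ℤ, EqOn (eulerL (zs.map (Int.cast : ℤ → ℝ)) g) 0 U := by
  obtain ⟨zs, hz⟩ := h
  exact ⟨zs, fun r hr => by rw [← eulerL_congr_eqOn hU hfg _ hr]; exact hz hr⟩

/-- KILLED: the zero function. -/
theorem killed_zero {U : Set ℝ} : ∃ zs : List ℤ, EqOn (eulerL (zs.map (Int.cast : ℤ → ℝ)) (fun _ : ℝ => (0 : ℝ))) 0 U :=
  ⟨[], fun r _ => by simp [eulerL_nil]⟩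

/-- THE r-PICTURE OF THE RADIAL ODE: if `4s g″ + (4L+6) g′ = −src` on `[0,∞)` then `(rD)(rD + 2L+1) g(r²) = −r²·src(r²)` on `(0,∞)`. -/
theorem eulerOp_eulerOp_comp_sq {g src : ℝ → ℝ} (hg : ContDiff ℝ ∞ g) (L : ℝ)
    (hode : ∀ s : ℝ, 0 ≤ s → 4 * s * deriv (deriv g) s + (4 * L + 6) * deriv g s = -src s) {r : ℝ} (hr : 0 < r) :
    eulerOp 0 (eulerOp (2 * L + 1) (fun x : ℝ => g (x ^ 2))) r = -(r ^ 2 * src (r ^ 2)) := by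
  have hsm : ContDiffOn ℝ ∞ (fun x : ℝ => g (x ^ 2)) (Ioi 0) := (hg.comp (contDiff_id.pow 2)).contDiffOn
  rw [eulerOp_eulerOp_apply hsm 0 (2 * L + 1) hr]
  have h1 : deriv (fun x : ℝ => g (x ^ 2)) r = 2 * r * deriv g (r ^ 2) :=
    deriv_profile_of_sq (H := fun x : ℝ => g (x ^ 2)) hg (fun x _ => rfl) hr
  have h2 : deriv (deriv (fun x : ℝ => g (x ^ 2))) r = 2 * deriv g (r ^ 2) + 4 * r ^ 2 * deriv (deriv g) (r ^ 2) :=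
    deriv_deriv_profile_of_sq (H := fun x : ℝ => g (x ^ 2)) hg (fun x _ => rfl) hr
  rw [h1, h2]
  have := hode (r ^ 2) (sq_nonneg r)
  linear_combination r ^ 2 * this

/-- the composed cascade coefficient `r ↦ g_k(r²)` is smooth on `(0,∞)`. -/
theorem contDiffOn_cascadeCoeff_sq (hl : 1 ≤ l) (hh : ContDiff ℝ ∞ h) (hHh : ∀ r : ℝ, 0 ≤ r → H r = h (r ^ 2))
    (hC : ∀ r : ℝ, 1 ≤ r → r ^ (l + 2) * |H r| ≤ C ∧ r ^ (l + 3) * |deriv H r| ≤ C ∧ r ^ (l + 4) * |deriv (deriv H) r| ≤ C)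
    {k : ℕ} (hk : k ≤ l) : ContDiffOn ℝ ∞ (fun x : ℝ => cascadeCoeff l h k (x ^ 2)) (Ioi 0) :=
  ((contDiff_cascadeCoeff hl hh hHh hC hk).comp (contDiff_id.pow 2)).contDiffOn

/-- ★ THE CASCADE ON A PLATEAU IS KILLED: for every level `k ≤ l` there is an integer Euler product annihilating `r ↦ g_k(r²)` on the
plateau interval. -/
theorem plateau_cascade_killed (hl : 1 ≤ l) (hh : ContDiff ℝ ∞ h) (hHh : ∀ r : ℝ, 0 ≤ r → H r = h (r ^ 2))
    (hC : ∀ r : ℝ, 1 ≤ r → r ^ (l + 2) * |H r| ≤ C ∧ r ^ (l + 3) * |deriv H r| ≤ C ∧ r ^ (l + 4) * |deriv (deriv H) r| ≤ C)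
    {a b : ℝ} (ha : 0 < a) (hK : ∀ r ∈ Ioo a b, vortAmpL l H r = 0) :
    ∀ k : ℕ, k ≤ l → ∃ zs : List ℤ, EqOn (eulerL (zs.map (Int.cast : ℤ → ℝ)) (fun x : ℝ => cascadeCoeff l h k (x ^ 2))) 0 (Ioo a b) := by
  have hJ : Ioo a b ⊆ Ioi 0 := fun r hr => ha.trans hr.1
  intro k
  induction k with
  | zero =>
    intro _
    -- source of level 0
    obtain ⟨zs, hz⟩ := plateau_cascadeSrc_killed hl hh hHh ha hK 0
    have hsrc : ContDiffOn ℝ ∞ (fun x : ℝ => cascadeSrc l h 0 (x ^ 2)) (Ioi 0) :=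
      ((contDiff_cascadeSrc hh l 0).comp (contDiff_id.pow 2)).contDiffOn
    have hg : ContDiffOn ℝ ∞ (fun x : ℝ => cascadeCoeff l h 0 (x ^ 2)) (Ioi 0) := contDiffOn_cascadeCoeff_sq hl hh hHh hC (by omega)
    -- `−r²·src` is killed
    obtain ⟨ws, hw⟩ := killed_const_mul hJ ((contDiffOn_id.pow 2).mul hsrc) (-1) (killed_pow_mul hJ hsrc 2 ⟨zs, hz⟩)
    refine ⟨ws ++ [0, ((2 * (2 * l) + 1 : ℕ) : ℤ)], ?_⟩
    rw [map_cast_append, eulerL_append]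
    have hode : EqOn (eulerL ([0, ((2 * (2 * l) + 1 : ℕ) : ℤ)].map (Int.cast : ℤ → ℝ)) (fun x : ℝ => cascadeCoeff l h 0 (x ^ 2)))
        (fun x => -1 * (x ^ 2 * cascadeSrc l h 0 (x ^ 2))) (Ioo a b) := by
      intro r hr
      simp only [List.map_cons, List.map_nil, eulerL_cons, eulerL_nil]
      have h := eulerOp_eulerOp_comp_sq (contDiff_cascadeCoeff hl hh hHh hC (by omega)) ((2 * l : ℕ) : ℝ)
        (fun s hs => cascadeCoeff_ode_zero hl hh hHh hC hs) (hJ hr)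
      push_cast at h ⊢
      rw [h]
      simp only [cascadeSrc]
      ring
    intro r hr
    rw [eulerL_congr_eqOn isOpen_Ioo hode _ hr]
    exact hw hr
  | succ k ih =>
    intro hk
    obtain ⟨zsp, hzp⟩ := ih (by omega)
    obtain ⟨zss, hzs⟩ := plateau_cascadeSrc_killed hl hh hHh ha hK (k + 1)
    have hsrc : ContDiffOn ℝ ∞ (fun x : ℝ => cascadeSrc l h (k + 1) (x ^ 2)) (Ioi 0) :=
      ((contDiff_cascadeSrc hh l (k + 1)).comp (contDiff_id.pow 2)).contDiffOn
    have hprev : ContDiffOn ℝ ∞ (fun x : ℝ => cascadeCoeff l h k (x ^ 2)) (Ioi 0) := contDiffOn_cascadeCoeff_sq hl hh hHh hC (by omega)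
    have hv : ContDiffOn ℝ ∞ (fun x : ℝ => cascadeSrc l h (k + 1) (x ^ 2) + cascadeCoeff l h k (x ^ 2)) (Ioi 0) := hsrc.add hprev
    obtain ⟨ws, hw⟩ := killed_const_mul hJ ((contDiffOn_id.pow 2).mul hv) (-1)
      (killed_pow_mul hJ hv 2 (killed_add isOpen_Ioo hJ hsrc hprev ⟨zss, hzs⟩ ⟨zsp, hzp⟩))
    refine ⟨ws ++ [0, ((2 * (2 * l - 2 * (k + 1)) + 1 : ℕ) : ℤ)], ?_⟩
    rw [map_cast_append, eulerL_append]
    have hode : EqOn (eulerL ([0, ((2 * (2 * l - 2 * (k + 1)) + 1 : ℕ) : ℤ)].map (Int.cast : ℤ → ℝ))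
        (fun x : ℝ => cascadeCoeff l h (k + 1) (x ^ 2)))
        (fun x => -1 * (x ^ 2 * (cascadeSrc l h (k + 1) (x ^ 2) + cascadeCoeff l h k (x ^ 2)))) (Ioo a b) := by
      intro r hr
      simp only [List.map_cons, List.map_nil, eulerL_cons, eulerL_nil]
      have h := eulerOp_eulerOp_comp_sq (contDiff_cascadeCoeff hl hh hHh hC hk) ((2 * l - 2 * (k + 1) : ℕ) : ℝ)
        (fun s hs => cascadeCoeff_ode_succ hl hh hHh hC hk hs) (hJ hr)
      push_cast at h ⊢
      rw [h]; ring
    intro r hr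
    rw [eulerL_congr_eqOn isOpen_Ioo hode _ hr]
    exact hw hr

end Propagation

section VortAmp

open scoped ContDiff

variable {H h : ℝ → ℝ}

/-- continuity of the vorticity amplitude: where `K ≠ 0` there is a whole interval of radii with `K ≠ 0`. -/
theorem exists_Ioo_vortAmpL_ne_zero (l : ℕ) (hh : ContDiff ℝ ∞ h) (hHh : ∀ r : ℝ, 0 ≤ r → H r = h (r ^ 2)) {s : ℝ} (hs : 0 < s)
    (hK : vortAmpL l H s ≠ 0) {ε : ℝ} (hε : 0 < ε) :
    ∃ η : ℝ, 0 < η ∧ η < ε ∧ η < s ∧ ∀ x ∈ Ioo (s - η) (s + η), vortAmpL l H x ≠ 0 := by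
  have hc := (continuousOn_vortAmpL l hh hHh).continuousAt (Ioi_mem_nhds hs)
  obtain ⟨δ, hδ, hball⟩ := Metric.eventually_nhds_iff.mp (hc.eventually_ne hK)
  refine ⟨min (δ / 2) (min (ε / 2) (s / 2)), by positivity, ?_, ?_, fun x hx => hball ?_⟩
  · have := min_le_right (δ / 2) (min (ε / 2) (s / 2)); have := min_le_left (ε / 2) (s / 2); linarith
  · have := min_le_right (δ / 2) (min (ε / 2) (s / 2)); have := min_le_right (ε / 2) (s / 2); linarith
  · rw [Real.dist_eq, abs_lt]
    have h1 := min_le_left (δ / 2) (min (ε / 2) (s / 2))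
    constructor <;> linarith [hx.1, hx.2]

end VortAmp

end Summit.NavierStokesRegularity.NavierStokesRegularity.Theorems.UnthreadedRigidity.VirialHorn
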